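import Summits.QuantumFields.YangMills.Theorems.UnitScaleTiltFluctuationComparisonRegPrGlobalSlackCanonicalPolymersCore
import Summits.QuantumFields.YangMills.Theorems.UnitScaleTiltFluctuationComparisonRegPrGlobalSlackCanonicalPolymersCover
import Summits.QuantumFields.YangMills.Theorems.UnitScaleTiltFluctuationComparisonRegPrGlobalSlackCanonicalPolymersVolumeC
import Summits.QuantumFields.YangMills.Theorems.UnitScaleTiltFluctuationComparisonRegPrGlobalSlackCanonicalPolymersMatched
import Summits.QuantumFields.YangMills.Theorems.UnitScaleTiltFluctuationComparisonRegPrGlobalSlackLocalToGlobalCount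
import HarnessLib

/-!
# `UnitScaleTiltFluctuationComparisonRegPrGlobalSlackCanonicalPolymersCoreRows` — PRODUCER ROWS 2–4 (COVER, VOLUME, MATCHING) FOR THE CANONICAL POLYMERISATION OF A FAMILY OF DATA CORES
# (crux `FluctuationComparisonRegPrIntL`, stmt-QuantumFields-20520, skeleton v5kC (OWNER C3, R-57χ): STUBS 3⁗χ `stub_globalTwoRunSlackFamChi` / (i*)χ `stub_smallBlocksSlackOnChiAllChi`;
# width-lever lane B «(R1) print's χ of [Balaban1985UV3] (47) back», seat ym-ust-19935-r1 g4; core port 2/5)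

Lane A's producer rows for `canonPolymer p` (`locCover_canon` in `…Cover`, the `volWeight`-volume `volWeight_mul_pow_le_sum_indicator_canon` in `…VolumeC` (p543849),
`locBlockVolume_canon` in `…Volume` (p534516), `locMatched_canon` in `…Matched`) stated ONCE over the row-stable data core: for `q : ∀ K, AlphaInputsT3AC.PkgCoreV3 F 𝔠 γ hγ hγ1 K`
and the core canonical polymerisation `canonPolymerCore q` (`…CanonicalPolymersCore`),

* §1 `canonTreeLenCore_domSet`, `canonTreeLenCore_nonneg`, **`locCover_canonCore`** : `LocCover (dataOfCoreV3 q (canonPolymerCore q)) κ (max 1 K₀(32,6))` for `0 ≤ κ`, `κ₀(32,6) ≤ κ`;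
* §2 **`volWeight_mul_pow_le_sum_indicator_canonCore`** / **`locBlockVolumeC_canonCore`** : `LocBlockVolumeC (dataOfCoreV3 q (canonPolymerCore q)) (volWeight L M₁)` (NO letter on `M₁`),
  and under the letter `L ≤ M₁` (`volWeight = 1`) the plain row **`locBlockVolume_canonCore`**;
* §3 `mem_newDomsCore_triv_iff`, **`locMatched_canonCore`** : `LocMatched (dataOfCoreV3 q (canonPolymerCore q))`.
Proofs are lane A's VERBATIM with `p ↦ q` (every p-free geometric lemma — `domSet_injective`, `exists_site_of_label`, `volWeight_mul_pow_le_sum_indicator_domSet`,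
`refineSet_domSet`, `liftSite`, … — is IMPORTED from lane A's files, not restated).  Both the old family (`q := toCore ∘ p`, `p : ∀ K, PkgAtV3`, where these rows ARE lane A's by
`canonPolymer_eq_core`) and the χ-record's family (`q := toCore ∘ p`, `p : ∀ K, PkgAtV3Chi`, datum `dataOfV3chi p π`) are instances.  Hypothesis-free bookkeeping/geometry;
nothing of [Balaban1985UV3] is asserted.

References: T. Bałaban, CMP 102 (1985) 255–275 [Balaban1985UV3] ((24)–(25) p.262, (39) p.266, (43)–(46) pp.266–267, (59) p.270); CMP 109 (1987) 249–301 [Balaban1987RG1]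
((0.1) p.251, (0.26) p.257, (0.30) p.258).
-/

set_option autoImplicit false

noncomputable section

namespace Summit.QuantumFields.YangMills.Theorems.GlobalSlackCanonicalPolymers

open scoped BigOperators
open Finset
open Literature.MathematicalPhysics.QuantumFieldTheory.Balaban1983to89
open Literature.MathematicalPhysics.QuantumFieldTheory.Balaban1983to89.T3ContinuumYM3Torus
open Literature.MathematicalPhysics.QuantumFieldTheory.Balaban1983to89.T3AlphaInputsAC
open Literature.MathematicalPhysics.QuantumFieldTheory.Balaban1983to89.T3AlphaInputsACTwoRunLevel
open Literature.MathematicalPhysics.QuantumFieldTheory.Balaban1983to89.T3AlphaPolymerSocket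
open Literature.MathematicalPhysics.QuantumFieldTheory.Balaban1983to89.T3LevelShift
open Literature.MathematicalPhysics.QuantumFieldTheory.Balaban1983to89.TreeLengthTorus (tsys tcubeSys TPt hTree_torus)
open Summit.QuantumFields.Balaban3D.Proofs.TorusLift (val_coarsen)
open Literature.MathematicalPhysics.QuantumFieldTheory.Balaban1983to89.B12TreeDecay (kappa₀ K₀ K₀_pos)
open Literature.MathematicalPhysics.QuantumFieldTheory.Balaban1985CMP102
open Literature.MathematicalPhysics.QuantumFieldTheory.Balaban1985CMP102.Setting
open Summit.QuantumFields.Balaban3D.Carriers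
open Summit.QuantumFields.Balaban3D.Proofs.Primitives
open Summit.QuantumFields.YangMills.Theorems
open Summit.QuantumFields.YangMills.Theorems.GlobalSlackLocalToGlobalCount (LocBlockVolumeC)

variable {F : T3Family} {𝔠 : AlphaConsts F.L (suGroupModel 2).N} {γ : ℝ} {hγ : 0 < γ} {hγ1 : γ ≤ (min 𝔠.gamma0 1) ^ 2}

/-! ## §1 The cover row over the core -/

/-- **`canonTreeLenCore (domSet X) = dj X`** at term level `k+1` (`k ≤ m + K`): by injectivity the domains with the point set of `X` are `X` alone. [cite: Balaban1985UV3, (24)–(25) p.262] -/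
theorem canonTreeLenCore_domSet (q : ∀ K, AlphaInputsT3AC.PkgCoreV3 F 𝔠 γ hγ hγ1 K) (K k : ℕ) (hk : k ≤ F.m + K)
    (X : (tsys 3 (nblkOf (SK F 𝔠 γ hγ hγ1 K) 𝔠.lane.carrier k)).Dom) :
    canonTreeLenCore q K (k + 1) (domSet (F := F) 𝔠.lane.carrier.M₁ K k X) = (tsys 3 (nblkOf (SK F 𝔠 γ hγ hγ1 K) 𝔠.lane.carrier k)).dj X := by
  unfold canonTreeLenCore
  have hset : {X' : (tsys 3 (nblkOf (SK F 𝔠 γ hγ hγ1 K) 𝔠.lane.carrier k)).Dom |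
      domSet (F := F) 𝔠.lane.carrier.M₁ K k X' = domSet (F := F) 𝔠.lane.carrier.M₁ K k X} = {X} := by
    ext X'
    simp only [Set.mem_setOf_eq, Set.mem_singleton_iff]
    exact ⟨fun h => domSet_injective K k hk h, fun h => by rw [h]⟩
  show sInf ((fun X' => (tsys 3 (nblkOf (SK F 𝔠 γ hγ hγ1 K) 𝔠.lane.carrier k)).dj X') ''
    {X' : (tsys 3 (nblkOf (SK F 𝔠 γ hγ hγ1 K) 𝔠.lane.carrier k)).Dom | domSet (F := F) 𝔠.lane.carrier.M₁ K k X' = domSet (F := F) 𝔠.lane.carrier.M₁ K k X}) = _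
  rw [hset, Set.image_singleton, csInf_singleton]

/-- The canonical tree length is nonnegative (an infimum of tree lengths, or `0`). [cite: Balaban1985UV3, (24)–(25) p.262] -/
theorem canonTreeLenCore_nonneg (q : ∀ K, AlphaInputsT3AC.PkgCoreV3 F 𝔠 γ hγ hγ1 K) (K i : ℕ) (Y : Set (Site (F.P K) 0)) :
    0 ≤ canonTreeLenCore q K i Y := by
  unfold canonTreeLenCore
  refine Real.sInf_nonneg fun t ht => ?_
  obtain ⟨X, -, rfl⟩ := ht
  exact (tsys 3 _).dj_nonneg X


/-- **`LocCover` FOR THE CANONICAL POLYMERISATION OF EVERY FAMILY OF DATA CORES** (lane A's `locCover_canon`, p535293-lineage, over `PkgCoreV3`): for `0 ≤ κ` with `κ₀(32, 6) ≤ κ` (LQB's torus tree-decay threshold, d = 3), tree lengths are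
nonnegative and `Σ_{Y ∈ Loc ∋ y} e^{−κ𝓛(Y)} ≤ max 1 K₀(32, 6)` for every fine site `y` — old blocks are disjoint (≤ 1), the dummy domain is one (≤ 1), the retained new
domains through the big block of `y` are bounded by `hTree_torus`.  The producer's SECOND row, discharged. [cite: Balaban1985UV3, (45)-(46) p.267; Balaban1987RG1, (0.26) p.257, (0.30) p.258] -/
theorem locCover_canonCore (q : ∀ K, AlphaInputsT3AC.PkgCoreV3 F 𝔠 γ hγ hγ1 K) {κ : ℝ} (hκ0 : 0 ≤ κ) (hκ : kappa₀ (4 * 2 ^ 3) (2 * 3) ≤ κ) :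
    LocCover (AlphaInputsT3AC.dataOfCoreV3 q (canonPolymerCore q)) κ (max 1 (K₀ (4 * 2 ^ 3) (2 * 3))) := by
  classical
  refine ⟨fun K i Y => canonTreeLenCore_nonneg q K i Y, fun K j h i y => ?_⟩
  change ∑ Y ∈ canonLocCore q K j h i, Y.indicator (fun _ => Real.exp (-κ * canonTreeLenCore q K i Y)) y ≤ _
  have hK₀ : (1 : ℝ) ≤ max 1 (K₀ (4 * 2 ^ 3) (2 * 3)) := le_max_left _ _
  -- generic bound: each summand ≤ the indicator
  have hterm : ∀ Y : Set (Site (F.P K) 0), Y.indicator (fun _ => Real.exp (-κ * canonTreeLenCore q K i Y)) y ≤ Y.indicator (fun _ => (1 : ℝ)) y :=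
    fun Y => indicator_exp_le_indicator Y y hκ0 (canonTreeLenCore_nonneg q K i Y)
  have hterm0 : ∀ Y : Set (Site (F.P K) 0), 0 ≤ Y.indicator (fun _ => Real.exp (-κ * canonTreeLenCore q K i Y)) y :=
    fun Y => Set.indicator_nonneg (fun _ _ => (Real.exp_pos _).le) y
  cases j with
  | zero =>
    simp only [canonLocCore, Finset.sum_empty]
    exact le_trans zero_le_one hK₀
  | succ k =>
    by_cases hk : k + 1 ≤ K
    · by_cases hik : i = k + 1
      · -- NEW terms: the retained domains through the big block of `y`
        subst hik
        have hkm : k ≤ F.m + K := by have := F.hm; omega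
        simp only [canonLocCore, if_pos hk, ite_true]
        rw [Finset.sum_image (fun X _ X' _ h => domSet_injective K k hkm h)]
        simp only [canonTreeLenCore_domSet q K k hkm]
        by_cases hlab : ∀ μ, bigBlockOf 𝔠.lane.carrier.M₁ k y μ < nblkOf (SK F 𝔠 γ hγ hγ1 K) 𝔠.lane.carrier k
        · have hind : ∀ X ∈ newDomsCore q K k h,
              (domSet (F := F) 𝔠.lane.carrier.M₁ K k X).indicator (fun _ => Real.exp (-κ * (tsys 3 _).dj X)) y =
                if labelOf (F := F) 𝔠.lane.carrier.M₁ K k y ∈ X.1 then Real.exp (-κ * (tsys 3 _).dj X) else 0 := by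
            intro X _
            rw [Set.indicator_apply]
            simp only [mem_domSet_iff_label _ K k X y hlab]
          rw [Finset.sum_congr rfl hind, ← Finset.sum_filter]
          refine le_trans ?_ (le_max_right _ _)
          refine le_trans (Finset.sum_le_sum_of_subset_of_nonneg ?_ fun X _ _ => (Real.exp_pos _).le)
            (hTree_torus 3 (nblkOf (SK F 𝔠 γ hγ hγ1 K) 𝔠.lane.carrier k) hκ (labelOf (F := F) 𝔠.lane.carrier.M₁ K k y))
          intro X hX
          rw [Finset.mem_filter] at hX
          simp only [B12TreeDecay.CubeSystem.toCubeCover_above, B12TreeDecay.CubeSystem.mem_above, TreeLengthTorus.tcubeSys_cubes]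
          exact hX.2
        · have hzero : ∀ X ∈ newDomsCore q K k h,
              (domSet (F := F) 𝔠.lane.carrier.M₁ K k X).indicator (fun _ => Real.exp (-κ * (tsys 3 _).dj X)) y = 0 :=
            fun X _ => Set.indicator_of_notMem (not_mem_domSet_of_label_ge _ K k X y hlab) _
          rw [Finset.sum_congr rfl hzero, Finset.sum_const_zero]
          exact le_trans zero_le_one hK₀
      · by_cases hi : i ∈ Finset.Icc 1 k
        · -- OLD terms: disjoint blocks, at most one contains `y`
          simp only [canonLocCore, if_pos hk, if_neg hik, if_pos hi]
          refine le_trans ?_ hK₀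
          set S := (oldBlocks 𝔠.lane.carrier.M₁ (rcolOf (SK F 𝔠 γ hγ hγ1 K) 𝔠.lane.carrier) h i).image (blockSet K i) with hS
          set B₀ : Set (Site (F.P K) 0) := blockSet K i (coarsen i y) with hB₀
          have hle : ∀ Y ∈ S, Y.indicator (fun _ => Real.exp (-κ * canonTreeLenCore q K i Y)) y ≤ if Y = B₀ then (1 : ℝ) else 0 := by
            intro Y hY
            refine (hterm Y).trans ?_
            by_cases hyY : y ∈ Y
            · obtain ⟨y', -, rfl⟩ := Finset.mem_image.mp hY
              have : blockSet K i y' = B₀ := by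
                have hc : coarsen i y = y' := hyY
                rw [hB₀, hc]
              rw [Set.indicator_of_mem hyY, if_pos this]
            · rw [Set.indicator_of_notMem hyY]
              split_ifs <;> norm_num
          refine (Finset.sum_le_sum hle).trans ?_
          rw [Finset.sum_ite_eq']
          split_ifs <;> norm_num
        · simp only [canonLocCore, if_pos hk, if_neg hik, if_neg hi, Finset.sum_empty]
          exact le_trans zero_le_one hK₀
    · by_cases hi1 : i = 1
      · subst hi1
        simp only [canonLocCore, if_neg hk, ite_true, Finset.sum_singleton]
        exact le_trans ((hterm _).trans (by rw [Set.indicator_of_mem (Set.mem_univ y)])) hK₀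
      · simp only [canonLocCore, if_neg hk, if_neg hi1, Finset.sum_empty]
        exact le_trans zero_le_one hK₀

/-! ## §2 The weighted volume row over the core, and the plain row under `L ≤ M₁` -/

/-- **THE `volWeight`-WEIGHTED BLOCK VOLUME FOR THE CANONICAL POLYMERISATION OF EVERY FAMILY OF DATA CORES, NO CONDITION ON `M₁`** (lane A's p543849 over `PkgCoreV3`): every listed level-`i` domain `Y` of
`dataOfCoreV3 q (canonPolymerCore q)` has `volWeight L M₁ · L^{3i} ≤ #Y` — blocks exactly `L^{3i}`, the dummy whole-torus domain `8L^{3(m+K)} ≥ L³`, new-term domains a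
whole big block (§2); `volWeight ≤ 1` covers the first two.  This is `GlobalSlackLocalToGlobalCount.LocBlockVolumeC (dataOfCoreV3 q (canonPolymerCore q)) (volWeight L M₁)`
unfolded (producer row 3 in count form, discharged for every constants record). [cite: Balaban1985UV3, (24) p.262, (45)-(46) p.267] -/
theorem volWeight_mul_pow_le_sum_indicator_canonCore (q : ∀ K, AlphaInputsT3AC.PkgCoreV3 F 𝔠 γ hγ hγ1 K) (K j : ℕ)
    (h : (AlphaInputsT3AC.dataOfCoreV3 q (canonPolymerCore q)).Hist K j) (i : ℕ) (Y : Set (Site (F.P K) 0))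
    (hY : Y ∈ (AlphaInputsT3AC.dataOfCoreV3 q (canonPolymerCore q)).Loc K j h i) :
    volWeight F.L 𝔠.M₁ * (F.L : ℝ) ^ (3 * i) ≤ ∑ y : Site (F.P K) 0, Y.indicator (fun _ => (1 : ℝ)) y := by
  classical
  have hw1 : volWeight F.L 𝔠.M₁ ≤ 1 := volWeight_le_one _ _
  have hweak : ∀ {i : ℕ} {v : ℝ}, (F.L : ℝ) ^ (3 * i) ≤ v → volWeight F.L 𝔠.M₁ * (F.L : ℝ) ^ (3 * i) ≤ v := fun {i v} hv =>
    ((mul_le_mul_of_nonneg_right hw1 (by positivity)).trans_eq (one_mul _)).trans hv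
  change Y ∈ canonLocCore q K j h i at hY
  cases j with
  | zero => simp [canonLocCore] at hY
  | succ k =>
    by_cases hk : k + 1 ≤ K
    · by_cases hik : i = k + 1
      · subst hik
        simp only [canonLocCore, if_pos hk, ite_true, mem_image] at hY
        obtain ⟨X, -, rfl⟩ := hY
        exact volWeight_mul_pow_le_sum_indicator_domSet K k (by have := F.hm; omega) X
      · by_cases hi : i ∈ Finset.Icc 1 k
        · simp only [canonLocCore, if_pos hk, if_neg hik, if_pos hi, mem_image] at hY
          obtain ⟨y, -, rfl⟩ := hY
          have hik' : i ≤ F.m + K := by have := (Finset.mem_Icc.mp hi).2; have := F.hm; omega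
          exact hweak (le_of_eq (sum_indicator_blockSet K i hik' y).symm)
        · simp only [canonLocCore, if_pos hk, if_neg hik, if_neg hi] at hY
          simp at hY
    · by_cases hi1 : i = 1
      · subst hi1
        simp only [canonLocCore, if_neg hk, ite_true, mem_singleton] at hY
        subst hY
        refine hweak ?_
        rw [sum_indicator_eq_card, Finset.filter_true_of_mem (fun x _ => Set.mem_univ x), card_univ,
          LogComparisonPolymerBudget.card_site_zero]
        have hL1 : (1 : ℝ) ≤ F.L := by exact_mod_cast F.hL.2.le
        have hx0 : (0 : ℝ) ≤ (F.L : ℝ) ^ (3 * (F.m + K)) := by positivity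
        calc (F.L : ℝ) ^ (3 * 1) ≤ (F.L : ℝ) ^ (3 * (F.m + K)) := pow_le_pow_right₀ hL1 (by have := F.hm; omega)
          _ ≤ 8 * (F.L : ℝ) ^ (3 * (F.m + K)) := by linarith
      · simp only [canonLocCore, if_neg hk, if_neg hi1] at hY
        simp at hY



/-- **PRODUCER ROW 3 IN COUNT FORM FOR A FAMILY OF DATA CORES**: `LocBlockVolumeC (dataOfCoreV3 q (canonPolymerCore q)) (volWeight L M₁)` — the weighted row packaged
(weight positive by `volWeight_canon_pos`). [cite: Balaban1985UV3, (24) p.262, (45)-(46) p.267] -/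
theorem locBlockVolumeC_canonCore (q : ∀ K, AlphaInputsT3AC.PkgCoreV3 F 𝔠 γ hγ hγ1 K) :
    LocBlockVolumeC (AlphaInputsT3AC.dataOfCoreV3 q (canonPolymerCore q)) (volWeight F.L 𝔠.M₁) :=
  ⟨volWeight_canon_pos 𝔠, fun K j hh i Y hY => volWeight_mul_pow_le_sum_indicator_canonCore q K j hh i Y hY⟩

/-- Under the letter `L ≤ M₁` the volume weight is `1`. [cite: Balaban1985UV3, (24) p.262] -/
theorem volWeight_eq_one_of_le {L M₁ : ℕ} (hL : 0 < L) (hM : L ≤ M₁) : volWeight L M₁ = 1 := by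
  unfold volWeight
  refine min_eq_left ?_
  have hL' : (0 : ℝ) < L := by exact_mod_cast hL
  have h1 : (1 : ℝ) ≤ (M₁ : ℝ) / L := by
    rw [le_div_iff₀ hL', one_mul]; exact_mod_cast hM
  exact one_le_pow₀ h1

/-- **PRODUCER ROW 3 (PLAIN FORM) FOR A FAMILY OF DATA CORES UNDER `L ≤ M₁`**: `LocBlockVolume (dataOfCoreV3 q (canonPolymerCore q))` — the weighted row at weight `1`
(lane A's `locBlockVolume_canon`, p534516, over `PkgCoreV3`). [cite: Balaban1985UV3, (24) p.262, (45)-(46) p.267] -/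
theorem locBlockVolume_canonCore (q : ∀ K, AlphaInputsT3AC.PkgCoreV3 F 𝔠 γ hγ hγ1 K) (hM : F.L ≤ 𝔠.M₁) :
    LocBlockVolume (AlphaInputsT3AC.dataOfCoreV3 q (canonPolymerCore q)) := by
  intro K j hh i Y hY
  have h := volWeight_mul_pow_le_sum_indicator_canonCore q K j hh i Y hY
  rwa [volWeight_eq_one_of_le (by have := F.hL.2; omega) hM, one_mul] at h

/-! ## §3 The matching row over the core -/

variable (q : ∀ K, AlphaInputsT3AC.PkgCoreV3 F 𝔠 γ hγ hγ1 K)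

/-- At the trivial history a domain is retained iff its tree length is below the retained radius (`Ωblk = univ`). [cite: Balaban1985UV3, (59) p.270] -/
theorem mem_newDomsCore_triv_iff (K k : ℕ) (X : (tsys 3 (nblkOf (SK F 𝔠 γ hγ hγ1 K) 𝔠.lane.carrier k)).Dom) :
    X ∈ newDomsCore q K k (Hist.triv (F.P K) (k + 1)) ↔
      (tsys 3 (nblkOf (SK F 𝔠 γ hγ hγ1 K) 𝔠.lane.carrier k)).dj X < rretOf (SK F 𝔠 γ hγ hγ1 K) 𝔠.lane.carrier k := by
  have hΩ : ∀ b, b ∈ ΩblkOf 𝔠.lane.carrier.M₁ (rcolOf (SK F 𝔠 γ hγ hγ1 K) 𝔠.lane.carrier) (nblkOf (SK F 𝔠 γ hγ hγ1 K) 𝔠.lane.carrier k)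
      (Hist.triv (SK F 𝔠 γ hγ hγ1 K).P (k + 1)) := fun b => by
    rw [ΩblkOf_triv]; exact Finset.mem_univ b
  simp only [newDomsCore, StepSeries.loc, Finset.mem_filter, Finset.mem_univ, true_and]
  exact ⟨fun h => h.2, fun h => ⟨fun b _ => hΩ b, h⟩⟩



/-- **PRODUCER ROW 4 FOR THE CANONICAL POLYMERISATION OF A FAMILY OF DATA CORES: `LocMatched (dataOfCoreV3 q (canonPolymerCore q))`** (lane A's `locMatched_canon` over `PkgCoreV3`) — for `n ≤ K`, `1 ≤ i ≤ K − n`, `refineSet F K` is a bijection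
from `canonLocCore q K (K−n) triv i` onto `canonLocCore q (K+1) (K+1−n) triv (i+1)`: the old blocks (`i ≤ K − n − 1`) go to the old blocks one level up (`refineSet_blockSet`,
corners to corners), the new domains (`i = K − n`) to the transported new domains (`refineSet_domSet`; same tree length, same retained radius); injective because
`coarsenSite` is onto. [cite: Balaban1987RG1, (0.1) p.251] -/
theorem locMatched_canonCore : LocMatched (AlphaInputsT3AC.dataOfCoreV3 q (canonPolymerCore q)) := by
  classical
  intro K n hn i hi1 hi2
  change Set.BijOn (refineSet F K) ↑(canonLocCore q K (K - n) (Hist.triv (F.P K) (K - n)) i)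
    ↑(canonLocCore q (K + 1) (K + 1 - n) (Hist.triv (F.P (K + 1)) (K + 1 - n)) (i + 1))
  obtain ⟨k, hk⟩ : ∃ k, K - n = k + 1 := ⟨K - n - 1, by omega⟩
  have hk' : K + 1 - n = k + 1 + 1 := by omega
  rw [hk, hk']
  have hkK : k + 1 ≤ K := by omega
  have hkK' : k + 1 + 1 ≤ K + 1 := by omega
  have hkm : k ≤ F.m + K := by omega
  have hinj : Set.InjOn (refineSet F K) ↑(canonLocCore q K (k + 1) (Hist.triv (F.P K) (k + 1)) i) := (refineSet_injective K).injOn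
  by_cases hik : i = k + 1
  · -- the NEW level: domains to transported domains
    subst hik
    have hN := nblkOf_succ_eq (F := F) (𝔠 := 𝔠) (γ := γ) (hγ := hγ) (hγ1 := hγ1) K k
    have hL : (canonLocCore q K (k + 1) (Hist.triv (F.P K) (k + 1)) (k + 1) : Set (Set (Site (F.P K) 0))) =
        domSet (F := F) 𝔠.lane.carrier.M₁ K k ''
          ((newDomsCore q K k (Hist.triv (F.P K) (k + 1)) : Finset (tsys 3 (nblkOf (SK F 𝔠 γ hγ hγ1 K) 𝔠.lane.carrier k)).Dom) :
            Set (tsys 3 (nblkOf (SK F 𝔠 γ hγ hγ1 K) 𝔠.lane.carrier k)).Dom) := by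
      simp only [canonLocCore, if_pos hkK, ite_true, coe_image]
    have hR : (canonLocCore q (K + 1) (k + 1 + 1) (Hist.triv (F.P (K + 1)) (k + 1 + 1)) (k + 1 + 1) : Set (Set (Site (F.P (K + 1)) 0))) =
        domSet (F := F) 𝔠.lane.carrier.M₁ (K + 1) (k + 1) ''
          ((newDomsCore q (K + 1) (k + 1) (Hist.triv (F.P (K + 1)) (k + 1 + 1)) :
              Finset (tsys 3 (nblkOf (SK F 𝔠 γ hγ hγ1 (K + 1)) 𝔠.lane.carrier (k + 1))).Dom) :
            Set (tsys 3 (nblkOf (SK F 𝔠 γ hγ hγ1 (K + 1)) 𝔠.lane.carrier (k + 1))).Dom) := by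
      simp only [canonLocCore, if_pos hkK', ite_true, coe_image]
    rw [hL] at hinj
    rw [hL, hR]
    refine Set.BijOn.mk ?_ hinj ?_
    · rintro _ ⟨X, hX, rfl⟩
      refine ⟨domCast hN X, ?_, (refineSet_domSet hN _ K k hkm X).symm⟩
      rw [Finset.mem_coe, mem_newDomsCore_triv_iff] at hX ⊢
      rw [dj_domCast, rretOf_succ_eq K k (by omega)]
      exact hX
    · rintro _ ⟨X', hX', rfl⟩
      refine ⟨domSet (F := F) 𝔠.lane.carrier.M₁ K k (domCast hN.symm X'), ⟨domCast hN.symm X', ?_, rfl⟩, ?_⟩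
      · rw [Finset.mem_coe, mem_newDomsCore_triv_iff] at hX' ⊢
        rw [dj_domCast, ← rretOf_succ_eq K k (by omega)]
        exact hX'
      · rw [refineSet_domSet hN _ K k hkm, domCast_domCast]
  · -- an OLD level: blocks to blocks
    have hi : i ∈ Finset.Icc 1 k := Finset.mem_Icc.mpr ⟨hi1, by omega⟩
    have hi' : i + 1 ∈ Finset.Icc 1 (k + 1) := Finset.mem_Icc.mpr ⟨by omega, by omega⟩
    have hik' : ¬ (i + 1 = k + 1 + 1) := by omega
    have him : i ≤ F.m + K := by omega
    have hL : (canonLocCore q K (k + 1) (Hist.triv (F.P K) (k + 1)) i : Set (Set (Site (F.P K) 0))) =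
        blockSet K i '' ↑(oldBlocks 𝔠.lane.carrier.M₁ (rcolOf (SK F 𝔠 γ hγ hγ1 K) 𝔠.lane.carrier) (Hist.triv (F.P K) (k + 1)) i) := by
      simp only [canonLocCore, if_pos hkK, if_neg hik, if_pos hi, coe_image]
    have hR : (canonLocCore q (K + 1) (k + 1 + 1) (Hist.triv (F.P (K + 1)) (k + 1 + 1)) (i + 1) : Set (Set (Site (F.P (K + 1)) 0))) =
        blockSet (K + 1) (i + 1) ''
          ↑(oldBlocks 𝔠.lane.carrier.M₁ (rcolOf (SK F 𝔠 γ hγ hγ1 (K + 1)) 𝔠.lane.carrier) (Hist.triv (F.P (K + 1)) (k + 1 + 1)) (i + 1)) := by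
      simp only [canonLocCore, if_pos hkK', if_neg hik', if_pos hi', coe_image]
    rw [hL] at hinj
    rw [hL, hR]
    refine Set.BijOn.mk ?_ hinj ?_
    · rintro _ ⟨y, hy, rfl⟩
      refine ⟨liftSite F K i y, ?_, (refineSet_blockSet K i him y).symm⟩
      rw [Finset.mem_coe, mem_oldBlocks_triv_iff] at hy ⊢
      exact (isCorner_liftSite_iff _ K i y).mpr hy
    · rintro _ ⟨y', hy', rfl⟩
      refine ⟨blockSet K i ((liftSite F K i).symm y'), ⟨(liftSite F K i).symm y', ?_, rfl⟩, ?_⟩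
      · rw [Finset.mem_coe, mem_oldBlocks_triv_iff] at hy' ⊢
        rw [← isCorner_liftSite_iff _ K i, Equiv.apply_symm_apply]
        exact hy'
      · rw [refineSet_blockSet K i him, Equiv.apply_symm_apply]

end Summit.QuantumFields.YangMills.Theorems.GlobalSlackCanonicalPolymers

end
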